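import Literature.AlgebraicGeometry.HodgeTheory.WeilClassesSplitSquareZetaEight
import Literature.AlgebraicGeometry.HodgeTheory.WeilClassesCyclicPrymDegreeSevenTyping
import HarnessLib

/-!
# Deligne's `A₀ ⊗ ℚ(ζ₈)`: the Weil classes of the CM field `ℚ(ζ₈)` on `(T × T) × (T × T)` are algebraic — for every abelian variety `T` (rung R3 on a fact-free locus)

Family `hodge`, layer `Literature/AlgebraicGeometry/HodgeTheory`. Completion of `WeilClassesSplitSquareZetaEight`
(which produced, for every `c` with `c⁴ = -1`, a non-zero algebraic class `P_c` on the `ℚ(ζ₈)`-Weil line of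
Deligne's `A = A₀ ⊗ ℚ(ζ₈) = (T × T) × (T × T)`, `Ψ(X, Y) = (Φ₁Y, X)`, `Φ₁(x, y) = (-y, x)`): here the LINE
LEMMA — every joint eigenclass of the test endomorphisms `(x·𝟙 + y·Ψ)^*` on `H^{2g}(A)` with character
`(x + yρ)^{2g}` is a multiple of `P_ρ` (if `ρ⁴ = -1`) or zero (otherwise) — and hence

* `weilClassesField_zetaEight_le_algebraicClasses` — **for EVERY complex abelian variety `T` of dimension
  `g ≥ 1` and EVERY polynomial `P`, `weilClassesField A Ψ P (2g) ⊆ algebraicClasses A.X g`**: the Weil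
  classes `W_F ⊗ ℂ = ⊕_σ ⋀^{2g} V_{ℂ,σ}` (Moonen–Zarhin 1998 §1) of the CM field `F = ℚ(ζ₈) = ℚ(Ψ)`
  (`P = X⁴ + 1`, `[F : ℚ] = 4 > 2`, `e · 2m = 4 · 2g = 2 dim A`) are algebraic — the body of the ladder's
  rung R3 (`WeilTypeLadder.WeilClassesCMField`) AT the `g(g+1)/2`-dimensional loci
  `{T ⊗ ℚ(ζ₈) : T ∈ 𝒜_g}`, UNCONDITIONALLY (Deligne, LNM 900 Lemma 4.5 / Rem. 4.10 for `E = ℚ(ζ₈)`, on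
  the carriers; no named fact, no definition). R3: "nothing in print for the GENERAL member for any
  `e > 2`"; known loci so far: Schoen's cyclic Prym `36`-folds (`K = ℚ(ζ₇)`, mod the refereed fact), CM
  points (André, conditional). These are the first FACT-FREE typed points on R3.

PROOF of the line lemma: `Ψ⁴ = -𝟙` (`zetaEight_pow_four`), so `Ψ^*` on `H¹(A)` is annihilated by the
separable `X⁴ + 1` and is semisimple; its eigenvalues are the four `c = c₀ iᵏ` (`c₀⁴ = -1`), the
eigenspaces `V_c ⊇ {w_c(v) : v ∈ H¹(T)}` have dimension `≥ 2g` each (`w_c` is injective: `q₀` has a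
section killing `q₁, q₂, q₃`), hence `= 2g` (`b₁(A) = 8g`) and `H¹(A) = ⊕_c V_c` with bases
`w_c(e₁), …, w_c(e_{2g})`; in the wedge basis of `H^{2g}(A) = ⋀^{2g} H¹(A)` (`HasExteriorCohomologyH1`)
the operators `(x·𝟙 + y·Ψ)^*` are diagonal with characters `∏_{i∈S}(x + yλᵢ)`, and such a character
equals `(x + yρ)^{2g}` iff all `λᵢ = ρ` (`eq_of_forall_prod_natCast_add_eq_pow`: evaluate the polynomial
identity at `X = -λᵢ`), i.e. iff `ρ = c` and `S` is the block of `c`, whose wedge vector is `P_c`.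

## References

* [Deligne1982HodgeCycles] P. Deligne, LNM 900 (1982), §4 Lemma 4.5, Remark 4.10.
* [MoonenZarhin1998WeilClasses] B. Moonen, Yu. Zarhin, Weil classes on abelian varieties (1998), §1.
* [vanGeemen1994HodgeAV] B. van Geemen, LNM 1594 (1994), 4.9 (the `f^*`-eigenspace convention); cf. the proof of Thm. 6.12
  (the `SL_{2n}`-decomposition of `⋀^{2p}(W ⊕ W^*)`; the wedge-eigenbasis bookkeeping below is folklore linear algebra, not that proof).
* [HatcherAT2002] A. Hatcher, Algebraic Topology (2002), §3.2.
-/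

noncomputable section

open CategoryTheory

namespace Literature.AlgebraicGeometry.HodgeTheory

open Literature.AlgebraicTopology.SingularHomology
open Literature.AlgebraicGeometry.Motives

section HodgeTheory

variable {T : Motives.AbelianVariety ℂ} {g : ℕ}

/-! ### The algebraic generator `P_c`, for a GIVEN basis `e` of `H¹(T)` (the construction of `WeilClassesSplitSquareZetaEight`, basis exposed) -/

/-- **The class `P_c = ∏ᵢ w_c(eᵢ)` is a non-zero algebraic `c`-Weil-line class**, for every basis `e` of
`H¹(T)` (same proof as `exists_mem_weilLine_zetaEight_algebraic_ne_zero`, with the basis a parameter so that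
the line lemma below can refer to it). [cite: Deligne1982HodgeCycles, §4 Lemma 4.5 and Remark 4.10] -/
theorem cupPowOne_zetaEight_mem_algebraicClasses_ne_zero (hg : 0 < g) (hT : T.dim = g) {c : ℂ}
    (hc : c ^ 4 = -1) (e : Module.Basis (Fin (2 * g)) ℂ (complexBetti T.X 1)) :
    let T₂ := T.prod T
    let Φ₁ : T₂ ⟶ T₂ := AbelianVariety.prodLift (AbelianVariety.snd T T ≫ (-(𝟙 T))) (AbelianVariety.fst T T)
    let Ψ : T₂.prod T₂ ⟶ T₂.prod T₂ :=
      AbelianVariety.prodLift (AbelianVariety.snd T₂ T₂ ≫ Φ₁) (AbelianVariety.fst T₂ T₂)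
    let A := T₂.prod T₂
    let P : complexBetti A.X (2 * g) := cupPowOne ℂ (Motives.ComplexPoints A.X) (2 * g) fun i =>
      complexBetti.map (AbelianVariety.fst T₂ T₂ ≫ AbelianVariety.fst T T).hom.hom.hom 1 (e i) +
        c ^ 2 • complexBetti.map (AbelianVariety.fst T₂ T₂ ≫ AbelianVariety.snd T T).hom.hom.hom 1 (e i) +
        c • complexBetti.map (AbelianVariety.snd T₂ T₂ ≫ AbelianVariety.fst T T).hom.hom.hom 1 (e i) +
        c ^ 3 • complexBetti.map (AbelianVariety.snd T₂ T₂ ≫ AbelianVariety.snd T T).hom.hom.hom 1 (e i)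
    P ∈ pullbackEigenclasses A Ψ (2 * g) (fun x y => ((x : ℂ) + (y : ℂ) * c) ^ (2 * g)) ∧
      P ∈ algebraicClasses A.X g ∧ P ≠ 0 := by
  intro T₂ Φ₁ Ψ A P₀
  classical
  -- the four projections
  let q : Fin 4 → (A ⟶ T) := ![AbelianVariety.fst T₂ T₂ ≫ AbelianVariety.fst T T,
    AbelianVariety.fst T₂ T₂ ≫ AbelianVariety.snd T T, AbelianVariety.snd T₂ T₂ ≫ AbelianVariety.fst T T,
    AbelianVariety.snd T₂ T₂ ≫ AbelianVariety.snd T T]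
  let expo : Fin 4 → ℕ := ![0, 2, 1, 3]
  have hc0 : c ≠ 0 := by rintro rfl; norm_num at hc
  have hX : IsSmoothProjective g T.X := Motives.isSmoothProjective_of_dim_eq' hT
  have hdimA : A.dim = 2 * (2 * g) := by
    change (T₂.prod T₂).dim = _
    rw [AbelianVariety.dim_prod, show T₂.dim = 2 * g from dim_twistedSquare hT]; ring
  have hXA : IsSmoothProjective (2 * (2 * g)) A.X := Motives.isSmoothProjective_of_dim_eq' hdimA
  -- a basis of `H¹(T)`, the top class `t`
  haveI := finite_complexBetti_abelianVariety T 1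
  have hb₁T : Module.finrank ℂ (complexBetti T.X 1) = 2 * g := by
    rw [AbelianVariety.finrank_complexBetti_one, hT]
  have hΛT := AbelianVariety.hasExteriorCohomologyH1_complexPoints T
  let BwT : Module.Basis (Set.powersetCard (Fin (2 * g)) (2 * g)) ℂ (complexBetti T.X (2 * g)) :=
    (e.exteriorPower (2 * g)).map (hΛT.equiv (2 * g))
  have hBwT : ∀ S, BwT S = cupPowOne ℂ (Motives.ComplexPoints T.X) (2 * g)
      (e ∘ (Set.powersetCard.ofFinEmbEquiv.symm S)) := by
    intro S
    change hΛT.equiv (2 * g) ((e.exteriorPower (2 * g)) S) = _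
    rw [exteriorPower.basis_apply, HasExteriorCohomologyH1.equiv_apply, exteriorPower.ιMulti_family,
      wedgeToCup_ιMulti]
  set t : complexBetti T.X (2 * g) := cupPowOne ℂ (Motives.ComplexPoints T.X) (2 * g) e with htdef
  have htBw : t = BwT (Set.powersetCard.ofFinEmbEquiv (RelEmbedding.refl _)) := by
    rw [hBwT, Equiv.symm_apply_apply, htdef]
    rfl
  have ht0 : t ≠ 0 := by rw [htBw]; exact BwT.ne_zero _
  have ht_alg : t ∈ algebraicClasses T.X g := mem_algebraicClasses_of_degree_top hX hg t
  -- the families `f j i = qⱼ^* eᵢ`, the eigenvector family `W` and the class `P`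
  let f : Fin 4 → Fin (2 * g) → complexBetti A.X 1 := fun j i => complexBetti.map (q j).hom.hom.hom 1 (e i)
  let W : Fin (2 * g) → complexBetti A.X 1 := fun i => ∑ j : Fin 4, c ^ expo j • f j i
  have hW : ∀ i, W i = f 0 i + c ^ 2 • f 1 i + c • f 2 i + c ^ 3 • f 3 i := by
    intro i
    change ∑ j : Fin 4, c ^ expo j • f j i = _
    rw [Fin.sum_univ_four]
    have h0 : expo 0 = 0 := rfl
    have h1 : expo 1 = 2 := rfl
    have h2 : expo 2 = 1 := rfl
    have h3 : expo 3 = 3 := rfl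
    rw [h0, h1, h2, h3, pow_zero, one_smul, pow_one]
  set P : complexBetti A.X (2 * g) := cupPowOne ℂ (Motives.ComplexPoints A.X) (2 * g) W with hPdef
  have hPeig : P ∈ pullbackEigenclasses A Ψ (2 * g) (fun x y => ((x : ℂ) + (y : ℂ) * c) ^ (2 * g)) := by
    have hWe : ∀ i, W i ∈ Module.End.eigenspace (complexBetti.map Ψ.hom.hom.hom 1).hom c := by
      intro i
      rw [hW]
      exact map_sum_smul_mem_eigenspace_zetaEight hc (e i)
    have h := cupPowOne_mem_pullbackEigenclasses (lam := fun _ => c) (v := W) hWe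
    have eχ : (fun x y : ℕ => ∏ _i : Fin (2 * g), ((x : ℂ) + (y : ℂ) * c)) =
        fun x y : ℕ => ((x : ℂ) + (y : ℂ) * c) ^ (2 * g) := by
      funext x y; rw [Finset.prod_const, Finset.card_univ, Fintype.card_fin]
    rw [← eχ]
    exact h
  -- the terms `τ_J`, `J : Fin 2g → Fin 4`, and the two expansions
  let τ : (Fin (2 * g) → Fin 4) → complexBetti A.X (2 * g) := fun J =>
    cupPowOne ℂ (Motives.ComplexPoints A.X) (2 * g) (fun i => f (J i) i)
  let sJ : (Fin (2 * g) → Fin 4) → ℕ := fun J => ∑ i, expo (J i)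
  have hP_sum : P = ∑ J : Fin (2 * g) → Fin 4, c ^ sJ J • τ J := by
    rw [hPdef]
    change cupPowOne ℂ _ (2 * g) (fun i => ∑ j ∈ (Finset.univ : Finset (Fin 4)), c ^ expo j • f j i) = _
    rw [MultilinearMap.map_sum_finset, Fintype.piFinset_univ]
    refine Finset.sum_congr rfl fun J _ => ?_
    rw [MultilinearMap.map_smul_univ, Finset.prod_pow_eq_pow_sum]
  set m : A ⟶ T := q 0 + q 1 + q 2 + q 3 with hmdef
  have hmt : complexBetti.map m.hom.hom.hom (2 * g) t = ∑ J : Fin (2 * g) → Fin 4, τ J := by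
    rw [htdef, complexBetti_map_cupPowOne]
    have e1 : (fun i => complexBetti.map m.hom.hom.hom 1 (e i)) =
        fun i => ∑ j ∈ (Finset.univ : Finset (Fin 4)), f j i := by
      funext i
      rw [Fin.sum_univ_four, hmdef, complexBetti_map_add_deg_one, complexBetti_map_add_deg_one,
        complexBetti_map_add_deg_one]
    rw [e1, MultilinearMap.map_sum_finset, Fintype.piFinset_univ]
  have hmt_alg : complexBetti.map m.hom.hom.hom (2 * g) t ∈ algebraicClasses A.X g :=
    map_mem_algebraicClasses_of_abelianVariety hXA T m.hom.hom.hom ht_alg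
  -- the separating endomorphism `u = (q₀, 4q₁, 2q₂, 8q₃)`: `u^* τ_J = 2^{s(J)} τ_J`
  let pw : Fin 4 → ℕ := ![1, 4, 2, 8]
  have hpw : ∀ j, pw j = 2 ^ expo j := by
    intro j; fin_cases j <;> rfl
  set u : A ⟶ A := AbelianVariety.prodLift (AbelianVariety.prodLift (q 0) ((pw 1) • q 1))
    (AbelianVariety.prodLift ((pw 2) • q 2) ((pw 3) • q 3)) with hudef
  have huq : ∀ j, u ≫ q j = (pw j) • q j := by
    intro j
    fin_cases j
    · change u ≫ (AbelianVariety.fst T₂ T₂ ≫ AbelianVariety.fst T T) = (1 : ℕ) • _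
      rw [← Category.assoc, hudef, AbelianVariety.prodLift_fst, AbelianVariety.prodLift_fst, one_smul]
      rfl
    · change u ≫ (AbelianVariety.fst T₂ T₂ ≫ AbelianVariety.snd T T) = (pw 1) • _
      rw [← Category.assoc, hudef, AbelianVariety.prodLift_fst, AbelianVariety.prodLift_snd]
      rfl
    · change u ≫ (AbelianVariety.snd T₂ T₂ ≫ AbelianVariety.fst T T) = (pw 2) • _
      rw [← Category.assoc, hudef, AbelianVariety.prodLift_snd, AbelianVariety.prodLift_fst]
      rfl
    · change u ≫ (AbelianVariety.snd T₂ T₂ ≫ AbelianVariety.snd T T) = (pw 3) • _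
      rw [← Category.assoc, hudef, AbelianVariety.prodLift_snd, AbelianVariety.prodLift_snd]
      rfl
  have huf : ∀ j i, complexBetti.map u.hom.hom.hom 1 (f j i) = ((2 : ℂ) ^ expo j) • f j i := by
    intro j i
    change complexBetti.map u.hom.hom.hom 1 (complexBetti.map (q j).hom.hom.hom 1 (e i)) = _
    rw [complexBetti_map_map_hom, huq, complexBetti_map_nsmul_deg_one, ← Nat.cast_smul_eq_nsmul ℂ, hpw,
      Nat.cast_pow, Nat.cast_ofNat]
  let U : complexBetti A.X (2 * g) →ₗ[ℂ] complexBetti A.X (2 * g) := (complexBetti.map u.hom.hom.hom (2 * g)).hom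
  have hUτ : ∀ J, U (τ J) = (2 : ℂ) ^ sJ J • τ J := by
    intro J
    change complexBetti.map u.hom.hom.hom (2 * g) (cupPowOne ℂ _ (2 * g) (fun i => f (J i) i)) = _
    rw [complexBetti_map_cupPowOne]
    have hfun : (fun i => complexBetti.map u.hom.hom.hom 1 (f (J i) i)) =
        fun i => ((2 : ℂ) ^ expo (J i)) • f (J i) i := by
      funext i; exact huf (J i) i
    rw [hfun, MultilinearMap.map_smul_univ, Finset.prod_pow_eq_pow_sum]
  have hU_alg : ∀ w ∈ algebraicClasses A.X g, U w ∈ algebraicClasses A.X g := fun w hw =>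
    map_mem_algebraicClasses_of_abelianVariety hXA A u.hom.hom.hom hw
  -- the projectors `Q_s`, `s ≤ 3·(2g)`
  have hsJ_le : ∀ J, sJ J ≤ 3 * (2 * g) := by
    intro J
    change ∑ i, expo (J i) ≤ _
    calc ∑ i, expo (J i) ≤ ∑ _i : Fin (2 * g), 3 :=
          Finset.sum_le_sum fun i _ => by
            change (![0, 2, 1, 3] : Fin 4 → ℕ) (J i) ≤ 3
            generalize J i = j
            fin_cases j <;> decide
      _ = 3 * (2 * g) := by rw [Finset.sum_const, Finset.card_univ, Fintype.card_fin, smul_eq_mul, mul_comm]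
  let ε : ℕ → ℕ → ℂ := fun k r => if r = k then 0 else (2 : ℂ) ^ r
  let Q : ℕ → (complexBetti A.X (2 * g) →ₗ[ℂ] complexBetti A.X (2 * g)) := fun k =>
    ((List.range (3 * (2 * g) + 1)).map fun r => U - ε k r • (LinearMap.id : _ →ₗ[ℂ] _)).prod
  have hQ_alg : ∀ k, ∀ {w : complexBetti A.X (2 * g)}, w ∈ algebraicClasses A.X g →
      Q k w ∈ algebraicClasses A.X g :=
    fun k _ hw => listProd_sub_smul_apply_mem (fun _ => U) (ε k) (algebraicClasses A.X g)
      (fun _ w hw => hU_alg w hw) (3 * (2 * g) + 1) hw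
  have hQτ : ∀ k J, Q k (τ J) = (∏ r ∈ Finset.range (3 * (2 * g) + 1), ((2 : ℂ) ^ sJ J - ε k r)) • τ J :=
    fun k J => listProd_sub_smul_apply_of_eigen (fun _ => U) (ε k) (fun _ => (2 : ℂ) ^ sJ J) (τ J)
      (fun _ => hUτ J) (3 * (2 * g) + 1)
  have hpow_inj : ∀ a b : ℕ, (2 : ℂ) ^ a = (2 : ℂ) ^ b → a = b := by
    intro a b h
    exact Nat.pow_right_injective le_rfl (by exact_mod_cast h)
  have hQτ_ne : ∀ k J, sJ J ≠ k → Q k (τ J) = 0 := by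
    intro k J hk
    rw [hQτ]
    have hmem : sJ J ∈ Finset.range (3 * (2 * g) + 1) :=
      Finset.mem_range.mpr (Nat.lt_succ_of_le (hsJ_le J))
    rw [Finset.prod_eq_zero hmem (by simp only [ε, if_neg hk, sub_self]), zero_smul]
  have hκ : ∀ k, (∏ r ∈ Finset.range (3 * (2 * g) + 1), ((2 : ℂ) ^ k - ε k r)) ≠ 0 := by
    intro k
    rw [Finset.prod_ne_zero_iff]
    intro r _
    by_cases hr : r = k
    · simp only [ε, if_pos hr, sub_zero]; exact pow_ne_zero _ two_ne_zero
    · simp only [ε, if_neg hr]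
      exact sub_ne_zero.mpr fun h => hr (hpow_inj _ _ h).symm
  -- `σ_k = Σ_{s(J) = k} τ_J` is algebraic
  have hσ_alg : ∀ k, (∑ J ∈ Finset.univ.filter (fun J : Fin (2 * g) → Fin 4 => sJ J = k), τ J) ∈
      algebraicClasses A.X g := by
    intro k
    have hQmt : Q k (complexBetti.map m.hom.hom.hom (2 * g) t) =
        (∏ r ∈ Finset.range (3 * (2 * g) + 1), ((2 : ℂ) ^ k - ε k r)) •
          ∑ J ∈ Finset.univ.filter (fun J : Fin (2 * g) → Fin 4 => sJ J = k), τ J := by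
      rw [hmt, map_sum, Finset.smul_sum, ← Finset.sum_filter_add_sum_filter_not Finset.univ
        (fun J : Fin (2 * g) → Fin 4 => sJ J = k)]
      rw [Finset.sum_eq_zero (s := Finset.univ.filter fun J : Fin (2 * g) → Fin 4 => ¬sJ J = k)
        (fun J hJ => hQτ_ne k J (Finset.mem_filter.mp hJ).2), add_zero]
      refine Finset.sum_congr rfl fun J hJ => ?_
      rw [hQτ, (Finset.mem_filter.mp hJ).2]
    have h := hQ_alg k hmt_alg
    rw [hQmt] at h
    simpa only [inv_smul_smul₀ (hκ k)] using (algebraicClasses A.X g).smul_mem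
      (∏ r ∈ Finset.range (3 * (2 * g) + 1), ((2 : ℂ) ^ k - ε k r))⁻¹ h
  -- hence `P` is algebraic
  have hP_alg : P ∈ algebraicClasses A.X g := by
    rw [hP_sum, ← Finset.sum_fiberwise_of_maps_to (s := Finset.univ) (t := Finset.range (3 * (2 * g) + 1))
      (g := sJ) (fun J _ => Finset.mem_range.mpr (Nat.lt_succ_of_le (hsJ_le J)))]
    refine Submodule.sum_mem _ fun k _ => ?_
    have hk : (∑ J ∈ Finset.univ.filter (fun J : Fin (2 * g) → Fin 4 => sJ J = k), c ^ sJ J • τ J) =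
        c ^ k • ∑ J ∈ Finset.univ.filter (fun J : Fin (2 * g) → Fin 4 => sJ J = k), τ J := by
      rw [Finset.smul_sum]
      refine Finset.sum_congr rfl fun J hJ => ?_
      rw [(Finset.mem_filter.mp hJ).2]
    rw [hk]
    exact (algebraicClasses A.X g).smul_mem _ (hσ_alg k)
  -- and non-zero: the `s = 0` class is `q₀^* t ≠ 0`
  have hs0 : ∀ J : Fin (2 * g) → Fin 4, sJ J = 0 → J = fun _ => 0 := by
    intro J hJ
    funext i
    have hi : expo (J i) = 0 := by
      have := Finset.sum_eq_zero_iff.mp hJ i (Finset.mem_univ i)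
      exact this
    revert hi
    generalize J i = j
    fin_cases j <;> decide
  have hτ0 : τ (fun _ => 0) = complexBetti.map (q 0).hom.hom.hom (2 * g) t := by
    change cupPowOne ℂ _ (2 * g) (fun i => f 0 i) = _
    rw [htdef, complexBetti_map_cupPowOne]
  have hq0t : complexBetti.map (q 0).hom.hom.hom (2 * g) t ≠ 0 := by
    intro h0
    apply ht0
    let s₀ : T ⟶ A := AbelianVariety.prodLift (AbelianVariety.prodLift (𝟙 T) 0) 0
    have hs : s₀ ≫ q 0 = 𝟙 T := by
      change AbelianVariety.prodLift (AbelianVariety.prodLift (𝟙 T) 0) 0 ≫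
        (AbelianVariety.fst T₂ T₂ ≫ AbelianVariety.fst T T) = 𝟙 T
      rw [← Category.assoc, AbelianVariety.prodLift_fst, AbelianVariety.prodLift_fst]
    have : complexBetti.map s₀.hom.hom.hom (2 * g) (complexBetti.map (q 0).hom.hom.hom (2 * g) t) = t := by
      rw [complexBetti_map_map_hom, hs]
      exact abelianVariety_map_id_apply t
    rw [← this, h0, map_zero]
  have hP0 : P ≠ 0 := by
    intro hP
    have h := congrArg (Q 0) hP_sum
    rw [hP, map_zero, map_sum, Finset.sum_eq_single (fun _ : Fin (2 * g) => (0 : Fin 4))] at h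
    · have hs00 : sJ (fun _ => 0) = 0 := by
        change ∑ i : Fin (2 * g), expo 0 = 0
        rw [show expo 0 = 0 from rfl, Finset.sum_const_zero]
      rw [map_smul, hQτ, hs00, pow_zero, one_smul, hτ0] at h
      exact (smul_ne_zero (hκ 0) hq0t) h.symm
    · intro J _ hJ
      rw [map_smul, hQτ_ne 0 J (fun hc' => hJ (hs0 J hc')), smul_zero]
    · intro h'; exact absurd (Finset.mem_univ _) h'
  have hPP₀ : P₀ = P := by
    change cupPowOne ℂ (Motives.ComplexPoints A.X) (2 * g) _ = cupPowOne ℂ (Motives.ComplexPoints A.X) (2 * g) W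
    congr 1
    funext i
    exact (hW i).symm
  rw [hPP₀]
  exact ⟨hPeig, hP_alg, hP0⟩


/-! ### Character uniqueness: `∏ᵢ (x + λᵢ) = (x + ρ)^N` for all `x ∈ ℕ` forces `λᵢ = ρ` -/

/-- If `∏ᵢ (x + λᵢ) = (x + ρ)^N` for every natural number `x`, then every `λᵢ = ρ`: the two
polynomials `∏ᵢ (X + λᵢ)` and `(X + ρ)^N` agree at infinitely many points, hence coincide; evaluate
at `X = -λᵢ`. [folklore] -/
theorem eq_of_forall_prod_natCast_add_eq_pow {N : ℕ} {lam : Fin N → ℂ} {ρ : ℂ}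
    (h : ∀ x : ℕ, ∏ i, ((x : ℂ) + lam i) = ((x : ℂ) + ρ) ^ N) (i : Fin N) : lam i = ρ := by
  classical
  have hN : N ≠ 0 := by
    rintro rfl
    exact Fin.elim0 i
  have hpq : (∏ j, (Polynomial.X + Polynomial.C (lam j)) : Polynomial ℂ) =
      (Polynomial.X + Polynomial.C ρ) ^ N := by
    apply Polynomial.eq_of_infinite_eval_eq
    refine Set.Infinite.mono ?_ (Set.infinite_range_of_injective (Nat.cast_injective (R := ℂ)))
    rintro _ ⟨x, rfl⟩
    simp only [Set.mem_setOf_eq, Polynomial.eval_prod, Polynomial.eval_add, Polynomial.eval_X,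
      Polynomial.eval_C, Polynomial.eval_pow]
    exact h x
  have h1 := congrArg (Polynomial.eval (-lam i)) hpq
  simp only [Polynomial.eval_prod, Polynomial.eval_add, Polynomial.eval_X, Polynomial.eval_C,
    Polynomial.eval_pow] at h1
  rw [Finset.prod_eq_zero (Finset.mem_univ i) (neg_add_cancel (lam i))] at h1
  have h3 := (pow_eq_zero_iff hN).mp h1.symm
  linear_combination -h3

/-! ### The line lemma: typed joint eigenspaces in `⋀^N` of a semisimple `φ^*` are at most lines -/

/-- **Typed joint eigenspaces are at most lines.** Let `φ` be an endomorphism of a complex abelian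
variety `A` whose pull-back `φ^*` on `H¹(A(ℂ); ℂ)` is semisimple, and let `N ≥ 1`, `ρ ∈ ℂ`. If the
`ρ`-eigenspace of `φ^*` on `H¹` has dimension `≤ N`, then the joint eigenspace
`pullbackEigenclasses A φ N ((x + yρ)^N)` of all test pull-backs `(x·𝟙 + y·φ)^*` on `H^N` has
dimension `≤ 1`, and it is `0` if that eigenspace has dimension `< N`. Proof (folklore wedge-eigenbasis
bookkeeping for an arbitrary number of eigenvalues; cf. van Geemen 4.9 and the decomposition in the proof of
Thm. 6.12): in an eigenbasis `b` of `H¹` the wedge basis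
`b_S` of `H^N = ⋀^N H¹` (`Motives.AbelianVariety.hasExteriorCohomologyH1_complexPoints`) diagonalises
every `(x·𝟙 + y·φ)^*` with character `∏_{i∈S} (x + yλᵢ)`, equal to `(x + yρ)^N` iff all `λᵢ = ρ`
(`eq_of_forall_prod_natCast_add_eq_pow`), i.e. iff `S ⊆ {i | λᵢ = ρ}` — a set of `≤ N` indices.
[cite: vanGeemen1994HodgeAV, 4.9 (cf. proof of Thm. 6.12)] -/
theorem finrank_pullbackEigenclasses_pow_le_one {A : Motives.AbelianVariety ℂ} {φ : A ⟶ A}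
    (hss : Module.End.IsSemisimple (complexBetti.map φ.hom.hom.hom 1).hom) {N : ℕ} (ρ : ℂ)
    (hmult : Module.finrank ℂ (Module.End.eigenspace (complexBetti.map φ.hom.hom.hom 1).hom ρ) ≤ N) :
    Module.finrank ℂ (pullbackEigenclasses A φ N (fun x y => ((x : ℂ) + (y : ℂ) * ρ) ^ N)) ≤ 1 ∧
      (Module.finrank ℂ (Module.End.eigenspace (complexBetti.map φ.hom.hom.hom 1).hom ρ) < N →
        pullbackEigenclasses A φ N (fun x y => ((x : ℂ) + (y : ℂ) * ρ) ^ N) = ⊥) := by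
  classical
  haveI := finite_complexBetti_abelianVariety A 1
  haveI := finite_complexBetti_abelianVariety A N
  have hΛ := Motives.AbelianVariety.hasExteriorCohomologyH1_complexPoints A
  set T : Module.End ℂ (complexBetti A.X 1) := (complexBetti.map φ.hom.hom.hom 1).hom with hT
  have htop : ⨆ μ, T.eigenspace μ = ⊤ := hss.iSup_eigenspace_eq_top
  have hint : DirectSum.IsInternal T.eigenspace :=
    DirectSum.isInternal_submodule_of_iSupIndep_of_iSup_eq_top T.eigenspaces_iSupIndep htop
  let bE : ∀ μ : ℂ, Module.Basis (Fin (Module.finrank ℂ (T.eigenspace μ))) ℂ (T.eigenspace μ) :=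
    fun μ => Module.finBasis ℂ _
  let b₀ := hint.collectedBasis bE
  letI : Fintype (Σ μ : ℂ, Fin (Module.finrank ℂ (T.eigenspace μ))) :=
    FiniteDimensional.fintypeBasisIndex b₀
  let e : (Σ μ : ℂ, Fin (Module.finrank ℂ (T.eigenspace μ))) ≃
      Fin (Fintype.card (Σ μ : ℂ, Fin (Module.finrank ℂ (T.eigenspace μ)))) := Fintype.equivFin _
  set M := Fintype.card (Σ μ : ℂ, Fin (Module.finrank ℂ (T.eigenspace μ))) with hM
  let b : Module.Basis (Fin M) ℂ (complexBetti A.X 1) := b₀.reindex e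
  let lam : Fin M → ℂ := fun i => (e.symm i).1
  have hb_mem : ∀ i, b i ∈ T.eigenspace (lam i) := by
    intro i
    rw [Module.Basis.reindex_apply]
    exact hint.collectedBasis_mem bE (e.symm i)
  have hact1 : ∀ (x y : ℕ) (i : Fin M), complexBetti.map (x • 𝟙 A + y • φ).hom.hom.hom 1 (b i) =
      ((x : ℂ) + (y : ℂ) * lam i) • b i := fun x y i =>
    complexBetti_map_nsmul_id_add_nsmul_one_of_mem_eigenspace (hb_mem i) x y
  -- the wedge basis of `H^N` and the action of the test pull-backs on it
  let Bw : Module.Basis (Set.powersetCard (Fin M) N) ℂ (complexBetti A.X N) :=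
    (b.exteriorPower N).map (hΛ.equiv N)
  have hBw : ∀ S, Bw S = cupPowOne ℂ (Motives.ComplexPoints A.X) N
      (b ∘ (Set.powersetCard.ofFinEmbEquiv.symm S)) := by
    intro S
    change hΛ.equiv N ((b.exteriorPower N) S) = _
    rw [exteriorPower.basis_apply, HasExteriorCohomologyH1.equiv_apply, exteriorPower.ιMulti_family,
      wedgeToCup_ιMulti]
  have hact : ∀ (p : ℕ × ℕ) (S : Set.powersetCard (Fin M) N),
      (complexBetti.map (p.1 • 𝟙 A + p.2 • φ).hom.hom.hom N).hom (Bw S) =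
        (∏ i : Fin N, ((p.1 : ℂ) + (p.2 : ℂ) * lam (Set.powersetCard.ofFinEmbEquiv.symm S i))) •
          Bw S := by
    intro p S
    rw [hBw]
    change singularCohomology.map ℂ ℂ
      (Motives.AlgPoints.mapContinuous (L := ℂ) (p.1 • 𝟙 A + p.2 • φ).hom.hom.hom) N
        (cupPowOne ℂ _ N _) = _
    rw [map_cupPowOne]
    have e' : (fun i => singularCohomology.map ℂ ℂ
        (Motives.AlgPoints.mapContinuous (L := ℂ) (p.1 • 𝟙 A + p.2 • φ).hom.hom.hom) 1
          ((b ∘ (Set.powersetCard.ofFinEmbEquiv.symm S)) i)) =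
        fun i => ((p.1 : ℂ) + (p.2 : ℂ) * lam (Set.powersetCard.ofFinEmbEquiv.symm S i)) •
          (b ∘ (Set.powersetCard.ofFinEmbEquiv.symm S)) i := by
      funext i
      exact hact1 p.1 p.2 _
    rw [e', MultilinearMap.map_smul_univ]
  -- the typed joint eigenspace is the span of the PURE wedges (all `N` eigenvalues `ρ`)
  let good : Set (Set.powersetCard (Fin M) N) :=
    {S | ∀ i : Fin N, lam (Set.powersetCard.ofFinEmbEquiv.symm S i) = ρ}
  have hE : pullbackEigenclasses A φ N (fun x y => ((x : ℂ) + (y : ℂ) * ρ) ^ N) =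
      Submodule.span ℂ (Bw '' good) := by
    ext c
    rw [mem_pullbackEigenclasses_iff]
    have h1 := forall_apply_eq_smul_iff_mem_span_image (P := ℕ × ℕ) Bw
      (fun p => (complexBetti.map (p.1 • 𝟙 A + p.2 • φ).hom.hom.hom N).hom)
      (fun S p => ∏ i : Fin N, ((p.1 : ℂ) + (p.2 : ℂ) * lam (Set.powersetCard.ofFinEmbEquiv.symm S i)))
      (fun p S => hact p S) (fun p => ((p.1 : ℂ) + (p.2 : ℂ) * ρ) ^ N) c
    have hs : {S : Set.powersetCard (Fin M) N |
        (fun p : ℕ × ℕ => ∏ i : Fin N,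
            ((p.1 : ℂ) + (p.2 : ℂ) * lam (Set.powersetCard.ofFinEmbEquiv.symm S i))) =
          fun p : ℕ × ℕ => ((p.1 : ℂ) + (p.2 : ℂ) * ρ) ^ N} = good := by
      ext S
      simp only [Set.mem_setOf_eq, funext_iff, good]
      constructor
      · intro h i
        refine eq_of_forall_prod_natCast_add_eq_pow
          (lam := fun i => lam (Set.powersetCard.ofFinEmbEquiv.symm S i)) (fun x => ?_) i
        have hx := h (x, 1)
        simpa only [Nat.cast_one, one_mul] using hx
      · intro h p
        simp only [h, Finset.prod_const, Finset.card_univ, Fintype.card_fin]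
    rw [hs] at h1
    rw [← h1]
    exact ⟨fun h p => h p.1 p.2, fun h x y => h (x, y)⟩
  -- pure index sets are `N`-subsets of `I = {i | λᵢ = ρ}`, `|I| ≤ dim Eig(φ^*, ρ)`
  let I : Finset (Fin M) := Finset.univ.filter fun i => lam i = ρ
  have hIcard : I.card ≤ Module.finrank ℂ (T.eigenspace ρ) := by
    have hli : LinearIndependent ℂ (fun i : I =>
        (⟨b i, (Finset.mem_filter.mp i.2).2 ▸ hb_mem i⟩ : T.eigenspace ρ)) := by
      apply LinearIndependent.of_comp (T.eigenspace ρ).subtype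
      exact b.linearIndependent.comp (fun i : I => (i : Fin M)) Subtype.val_injective
    have h := hli.fintype_card_le_finrank
    rw [Fintype.card_coe] at h
    exact h
  have hsubI : ∀ S ∈ good, (S : Finset (Fin M)) ⊆ I := by
    intro S hS j hj
    rw [Finset.mem_filter]
    refine ⟨Finset.mem_univ _, ?_⟩
    obtain ⟨i, rfl⟩ := (Set.powersetCard.mem_range_ofFinEmbEquiv_symm_iff_mem S j).2 hj
    exact hS i
  have hsub : ∀ S ∈ good, (S : Finset (Fin M)) = I := fun S hS =>
    Finset.eq_of_subset_of_card_le (hsubI S hS)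
      (by rw [Set.powersetCard.card_eq]; exact hIcard.trans hmult)
  have hgood : good.Subsingleton := fun S hS S' hS' =>
    Subtype.ext ((hsub S hS).trans (hsub S' hS').symm)
  rw [hE]
  refine ⟨?_, fun hlt => ?_⟩
  · rcases good.eq_empty_or_nonempty with hg | ⟨S₀, hS₀⟩
    · rw [hg, Set.image_empty, Submodule.span_empty, finrank_bot]
      exact zero_le_one
    · rw [hgood.eq_singleton_of_mem hS₀, Set.image_singleton, finrank_span_singleton (Bw.ne_zero S₀)]
  · rcases good.eq_empty_or_nonempty with hg | ⟨S₀, hS₀⟩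
    · rw [hg, Set.image_empty, Submodule.span_empty]
    · exfalso
      have h1 := Finset.card_le_card (hsubI S₀ hS₀)
      rw [Set.powersetCard.card_eq] at h1
      exact absurd (h1.trans hIcard) (not_le.mpr hlt)

/-! ### `Ψ⁴ = -𝟙`: `Ψ^*` on `H¹` is semisimple with the four eigenvalues `c`, `c⁴ = -1`, each of multiplicity `2g` -/

/-- `Ψ⁴ = -𝟙` for Deligne's `Ψ(X, Y) = (Φ₁Y, X)`, `Φ₁(x,y) = (-y, x)` (componentwise from
`zetaEight_comp_proj`). [cite: Deligne1982HodgeCycles, §4 proof of Prop. 4.8] -/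
theorem zetaEight_pow_four (T : Motives.AbelianVariety ℂ) :
    let T₂ := T.prod T
    let Φ₁ : T₂ ⟶ T₂ := AbelianVariety.prodLift (AbelianVariety.snd T T ≫ (-(𝟙 T))) (AbelianVariety.fst T T)
    let Ψ : T₂.prod T₂ ⟶ T₂.prod T₂ :=
      AbelianVariety.prodLift (AbelianVariety.snd T₂ T₂ ≫ Φ₁) (AbelianVariety.fst T₂ T₂)
    Ψ ≫ Ψ ≫ Ψ ≫ Ψ = -(𝟙 (T₂.prod T₂)) := by
  intro T₂ Φ₁ Ψ
  have h : (Ψ ≫ (AbelianVariety.fst T₂ T₂ ≫ AbelianVariety.fst T T) =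
        -(AbelianVariety.snd T₂ T₂ ≫ AbelianVariety.snd T T)) ∧
      (Ψ ≫ (AbelianVariety.fst T₂ T₂ ≫ AbelianVariety.snd T T) =
        AbelianVariety.snd T₂ T₂ ≫ AbelianVariety.fst T T) ∧
      (Ψ ≫ (AbelianVariety.snd T₂ T₂ ≫ AbelianVariety.fst T T) =
        AbelianVariety.fst T₂ T₂ ≫ AbelianVariety.fst T T) ∧
      (Ψ ≫ (AbelianVariety.snd T₂ T₂ ≫ AbelianVariety.snd T T) =
        AbelianVariety.fst T₂ T₂ ≫ AbelianVariety.snd T T) := zetaEight_comp_proj T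
  obtain ⟨h0, h1, h2, h3⟩ := h
  apply AbelianVariety.prod_hom_ext <;> apply AbelianVariety.prod_hom_ext <;>
    simp only [Category.assoc, Preadditive.comp_neg, Preadditive.neg_comp, Category.id_comp,
      h0, h1, h2, h3]

/-- `(Ψ^*)⁴ = -1` on `H¹(A(ℂ); ℂ)`. [cite: Deligne1982HodgeCycles, §4 proof of Prop. 4.8] -/
theorem zetaEight_complexBetti_one_pow_four (T : Motives.AbelianVariety ℂ) :
    let T₂ := T.prod T
    let Φ₁ : T₂ ⟶ T₂ := AbelianVariety.prodLift (AbelianVariety.snd T T ≫ (-(𝟙 T))) (AbelianVariety.fst T T)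
    let Ψ : T₂.prod T₂ ⟶ T₂.prod T₂ :=
      AbelianVariety.prodLift (AbelianVariety.snd T₂ T₂ ≫ Φ₁) (AbelianVariety.fst T₂ T₂)
    (complexBetti.map Ψ.hom.hom.hom 1).hom ^ 4 = -1 := by
  intro T₂ Φ₁ Ψ
  have hc : ∀ f g : T₂.prod T₂ ⟶ T₂.prod T₂, (complexBetti.map (f ≫ g).hom.hom.hom 1).hom =
      (complexBetti.map f.hom.hom.hom 1).hom ∘ₗ (complexBetti.map g.hom.hom.hom 1).hom := by
    intro f g
    change (complexBetti.map (f.hom.hom.hom ≫ g.hom.hom.hom) 1).hom = _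
    rw [complexBetti.map_comp, ModuleCat.hom_comp]
  have h4 : Ψ ≫ Ψ ≫ Ψ ≫ Ψ = -(𝟙 (T₂.prod T₂)) := zetaEight_pow_four T
  have h := congrArg (fun u : T₂.prod T₂ ⟶ T₂.prod T₂ => (complexBetti.map u.hom.hom.hom 1).hom) h4
  dsimp only at h
  iterate 3 rw [hc] at h
  have hneg : (complexBetti.map (-(𝟙 (T₂.prod T₂))).hom.hom.hom 1).hom = -1 := by
    refine LinearMap.ext fun v => ?_
    rw [LinearMap.neg_apply, Module.End.one_apply]
    change complexBetti.map (-(𝟙 (T₂.prod T₂))).hom.hom.hom 1 v = -v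
    rw [complexBetti_map_neg_deg_one]
    exact congrArg Neg.neg (abelianVariety_map_id_apply v)
  rw [hneg] at h
  rw [← h]
  simp only [pow_succ, pow_zero, one_mul, Module.End.mul_eq_comp, LinearMap.comp_assoc]

/-- The fourth roots of unity in `ℂ` are `1, -1, i, -i`. [folklore] -/
theorem eq_of_pow_four_eq_one {z : ℂ} (hz : z ^ 4 = 1) :
    z = 1 ∨ z = -1 ∨ z = Complex.I ∨ z = -Complex.I := by
  have key : (z - 1) * (z + 1) * (z - Complex.I) * (z + Complex.I) = z ^ 4 - 1 := by
    linear_combination (1 - z ^ 2) * Complex.I_sq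
  rw [hz, sub_self] at key
  rcases mul_eq_zero.mp key with h | h
  · rcases mul_eq_zero.mp h with h | h
    · rcases mul_eq_zero.mp h with h | h
      · exact Or.inl (sub_eq_zero.mp h)
      · exact Or.inr (Or.inl (add_eq_zero_iff_eq_neg.mp h))
    · exact Or.inr (Or.inr (Or.inl (sub_eq_zero.mp h)))
  · exact Or.inr (Or.inr (Or.inr (add_eq_zero_iff_eq_neg.mp h)))

/-- **The eigenvalues of `Ψ^*` on `H¹(A)` and their multiplicities.** `Ψ^*` on `H¹(A(ℂ); ℂ)` is
semisimple, each eigenvalue `ρ` has multiplicity `≤ 2g`, and multiplicity `< 2g` (indeed `0`) unless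
`ρ⁴ = -1` (then `= 2g`: the four eigenspaces contain the `2g`-dimensional images of the injective maps
`v ↦ w_ρ(v)` and `b₁(A) = 8g`). [cite: Deligne1982HodgeCycles, §4 proof of Prop. 4.8] -/
theorem isSemisimple_and_finrank_eigenspace_zetaEight_le (hg : 0 < g) (hT : T.dim = g) (ρ : ℂ) :
    let T₂ := T.prod T
    let Φ₁ : T₂ ⟶ T₂ := AbelianVariety.prodLift (AbelianVariety.snd T T ≫ (-(𝟙 T))) (AbelianVariety.fst T T)
    let Ψ : T₂.prod T₂ ⟶ T₂.prod T₂ :=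
      AbelianVariety.prodLift (AbelianVariety.snd T₂ T₂ ≫ Φ₁) (AbelianVariety.fst T₂ T₂)
    Module.End.IsSemisimple (complexBetti.map Ψ.hom.hom.hom 1).hom ∧
      Module.finrank ℂ (Module.End.eigenspace (complexBetti.map Ψ.hom.hom.hom 1).hom ρ) ≤ 2 * g ∧
      (ρ ^ 4 ≠ -1 →
        Module.finrank ℂ (Module.End.eigenspace (complexBetti.map Ψ.hom.hom.hom 1).hom ρ) < 2 * g) := by
  intro T₂ Φ₁ Ψ
  classical
  let A := T₂.prod T₂
  haveI := finite_complexBetti_abelianVariety A 1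
  haveI := finite_complexBetti_abelianVariety T 1
  set TΨ : Module.End ℂ (complexBetti A.X 1) := (complexBetti.map Ψ.hom.hom.hom 1).hom with hTΨ
  have h4 : TΨ ^ 4 = -1 := zetaEight_complexBetti_one_pow_four T
  have hss : Module.End.IsSemisimple TΨ := by
    refine Module.End.isSemisimple_of_squarefree_aeval_eq_zero
      (Polynomial.separable_X_pow_sub_C (-1 : ℂ) (n := 4) (by norm_num) (by norm_num)).squarefree ?_
    simp only [map_sub, map_pow, map_neg, map_one, Polynomial.aeval_X, h4, sub_self]
  -- eigenvalues are fourth roots of `-1`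
  have heig : ∀ μ : ℂ, TΨ.eigenspace μ ≠ ⊥ → μ ^ 4 = -1 := by
    intro μ hμ
    obtain ⟨v, hv, hv0⟩ := (Submodule.ne_bot_iff _).mp hμ
    have h := pow_apply_of_mem_eigenspace hv 4
    rw [h4, LinearMap.neg_apply, Module.End.one_apply] at h
    have h2 : (μ ^ 4 + 1) • v = 0 := by rw [add_smul, one_smul, ← h, neg_add_cancel]
    exact eq_neg_of_add_eq_zero_left ((smul_eq_zero.mp h2).resolve_right hv0)
  -- a fixed fourth root `c₀` of `-1` and the four roots `c₀, -c₀, c₀ i, -c₀ i`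
  obtain ⟨c₀, hc₀⟩ : ∃ z : ℂ, z ^ 4 = -1 := IsAlgClosed.exists_pow_nat_eq (-1) (by norm_num)
  have hc₀0 : c₀ ≠ 0 := by
    rintro rfl
    norm_num at hc₀
  let rt : Fin 4 → ℂ := ![1, -1, Complex.I, -Complex.I]
  have hI4 : Complex.I ^ 4 = 1 := by linear_combination (Complex.I ^ 2 - 1) * Complex.I_sq
  have hrt4 : ∀ k, rt k ^ 4 = 1 := by
    intro k
    fin_cases k
    · exact one_pow 4
    · change (-1 : ℂ) ^ 4 = 1
      norm_num
    · exact hI4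
    · change (-Complex.I) ^ 4 = 1
      rw [neg_pow, hI4]
      norm_num
  let cs : Fin 4 → ℂ := fun k => c₀ * rt k
  have hcs4 : ∀ k, cs k ^ 4 = -1 := by
    intro k
    change (c₀ * rt k) ^ 4 = -1
    rw [mul_pow, hc₀, hrt4, mul_one]
  have hcs_inj : Function.Injective cs := by
    intro j k hjk
    have hrt : rt j = rt k := mul_left_cancel₀ hc₀0 hjk
    have hre := congrArg Complex.re hrt
    have him := congrArg Complex.im hrt
    revert hre him
    fin_cases j <;> fin_cases k <;>
      first
      | exact fun _ _ => rfl
      | (intro hre him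
         simp [rt] at hre him <;> linarith)
  have hroot : ∀ μ : ℂ, μ ^ 4 = -1 → ∃ k, μ = cs k := by
    intro μ hμ
    have hz : (μ / c₀) ^ 4 = 1 := by
      rw [div_pow, hμ, hc₀, div_self (by norm_num : (-1 : ℂ) ≠ 0)]
    have hμ' : μ = c₀ * (μ / c₀) := by field_simp
    rcases eq_of_pow_four_eq_one hz with h | h | h | h
    · exact ⟨0, by rw [hμ']; change c₀ * (μ / c₀) = c₀ * 1; rw [h]⟩
    · exact ⟨1, by rw [hμ']; change c₀ * (μ / c₀) = c₀ * (-1); rw [h]⟩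
    · exact ⟨2, by rw [hμ']; change c₀ * (μ / c₀) = c₀ * Complex.I; rw [h]⟩
    · exact ⟨3, by rw [hμ']; change c₀ * (μ / c₀) = c₀ * (-Complex.I); rw [h]⟩
  -- lower bound: `dim Eig(Ψ^*, c) ≥ 2g` for every `c⁴ = -1` (the injective map `v ↦ w_c(v)`)
  have hb₁T : Module.finrank ℂ (complexBetti T.X 1) = 2 * g := by
    rw [AbelianVariety.finrank_complexBetti_one, hT]
  have hlow : ∀ c : ℂ, c ^ 4 = -1 → 2 * g ≤ Module.finrank ℂ (TΨ.eigenspace c) := by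
    intro c hc
    let P0 : complexBetti T.X 1 →ₗ[ℂ] complexBetti A.X 1 :=
      (complexBetti.map (AbelianVariety.fst T₂ T₂ ≫ AbelianVariety.fst T T).hom.hom.hom 1).hom
    let P1 : complexBetti T.X 1 →ₗ[ℂ] complexBetti A.X 1 :=
      (complexBetti.map (AbelianVariety.fst T₂ T₂ ≫ AbelianVariety.snd T T).hom.hom.hom 1).hom
    let P2 : complexBetti T.X 1 →ₗ[ℂ] complexBetti A.X 1 :=
      (complexBetti.map (AbelianVariety.snd T₂ T₂ ≫ AbelianVariety.fst T T).hom.hom.hom 1).hom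
    let P3 : complexBetti T.X 1 →ₗ[ℂ] complexBetti A.X 1 :=
      (complexBetti.map (AbelianVariety.snd T₂ T₂ ≫ AbelianVariety.snd T T).hom.hom.hom 1).hom
    let L : complexBetti T.X 1 →ₗ[ℂ] complexBetti A.X 1 := P0 + c ^ 2 • P1 + c • P2 + c ^ 3 • P3
    have hLapply : ∀ v, L v = P0 v + c ^ 2 • P1 v + c • P2 v + c ^ 3 • P3 v := by
      intro v
      simp only [L, LinearMap.add_apply, LinearMap.smul_apply]
    -- the section `s₀ = (𝟙, 0, 0, 0)` of `q₀`
    let s₀ : T ⟶ A := AbelianVariety.prodLift (AbelianVariety.prodLift (𝟙 T) 0) 0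
    have hs0 : s₀ ≫ (AbelianVariety.fst T₂ T₂ ≫ AbelianVariety.fst T T) = 𝟙 T := by
      rw [← Category.assoc, AbelianVariety.prodLift_fst, AbelianVariety.prodLift_fst]
    have hs1 : s₀ ≫ (AbelianVariety.fst T₂ T₂ ≫ AbelianVariety.snd T T) = 0 := by
      rw [← Category.assoc, AbelianVariety.prodLift_fst, AbelianVariety.prodLift_snd]
    have hs2 : s₀ ≫ (AbelianVariety.snd T₂ T₂ ≫ AbelianVariety.fst T T) = 0 := by
      rw [← Category.assoc, AbelianVariety.prodLift_snd, Limits.zero_comp]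
    have hs3 : s₀ ≫ (AbelianVariety.snd T₂ T₂ ≫ AbelianVariety.snd T T) = 0 := by
      rw [← Category.assoc, AbelianVariety.prodLift_snd, Limits.zero_comp]
    have hsec : ∀ v, complexBetti.map s₀.hom.hom.hom 1 (L v) = v := by
      intro v
      rw [hLapply, map_add, map_add, map_add, map_smul, map_smul, map_smul]
      change complexBetti.map s₀.hom.hom.hom 1 (complexBetti.map _ 1 v) +
          c ^ 2 • complexBetti.map s₀.hom.hom.hom 1 (complexBetti.map _ 1 v) +
          c • complexBetti.map s₀.hom.hom.hom 1 (complexBetti.map _ 1 v) +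
          c ^ 3 • complexBetti.map s₀.hom.hom.hom 1 (complexBetti.map _ 1 v) = v
      rw [complexBetti_map_map_hom, complexBetti_map_map_hom, complexBetti_map_map_hom,
        complexBetti_map_map_hom, hs0, hs1, hs2, hs3, complexBetti_map_zero_deg_one, smul_zero,
        smul_zero, smul_zero, add_zero, add_zero, add_zero]
      exact abelianVariety_map_id_apply v
    have hinj : Function.Injective L := fun v w hvw => by
      have h := congrArg (complexBetti.map s₀.hom.hom.hom 1) hvw
      rwa [hsec, hsec] at h
    have hrange : LinearMap.range L ≤ TΨ.eigenspace c := by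
      rintro _ ⟨v, rfl⟩
      rw [hLapply]
      exact map_sum_smul_mem_eigenspace_zetaEight hc v
    calc 2 * g = Module.finrank ℂ (LinearMap.range L) := by
          rw [LinearMap.finrank_range_of_inj hinj, hb₁T]
      _ ≤ Module.finrank ℂ (TΨ.eigenspace c) := Submodule.finrank_mono hrange
  -- `H¹(A) = ⊕_k Eig(Ψ^*, c_k)`, so the four multiplicities add up to `b₁(A) = 8g`: all are `2g`
  have htop : ⨆ μ, TΨ.eigenspace μ = ⊤ := hss.iSup_eigenspace_eq_top
  have htop4 : ⨆ k, TΨ.eigenspace (cs k) = ⊤ := by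
    refine le_antisymm le_top ?_
    rw [← htop]
    refine iSup_le fun μ => ?_
    by_cases hμ : TΨ.eigenspace μ = ⊥
    · rw [hμ]; exact bot_le
    · obtain ⟨k, rfl⟩ := hroot μ (heig μ hμ)
      exact le_iSup (fun k => TΨ.eigenspace (cs k)) k
  have hind4 : iSupIndep fun k => TΨ.eigenspace (cs k) := TΨ.eigenspaces_iSupIndep.comp hcs_inj
  have hint4 : DirectSum.IsInternal fun k => TΨ.eigenspace (cs k) :=
    DirectSum.isInternal_submodule_of_iSupIndep_of_iSup_eq_top hind4 htop4
  let b4 := hint4.collectedBasis fun k => Module.finBasis ℂ (TΨ.eigenspace (cs k))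
  have hsum : ∑ k, Module.finrank ℂ (TΨ.eigenspace (cs k)) = 4 * (2 * g) := by
    have h := Module.finrank_eq_card_basis b4
    rw [Fintype.card_sigma] at h
    simp only [Fintype.card_fin] at h
    rw [← h, AbelianVariety.finrank_complexBetti_one]
    change 2 * (T₂.prod T₂).dim = _
    rw [AbelianVariety.dim_prod, show T₂.dim = 2 * g from dim_twistedSquare hT]
    ring
  have heq : ∀ k, Module.finrank ℂ (TΨ.eigenspace (cs k)) = 2 * g := by
    have hle : ∀ k ∈ (Finset.univ : Finset (Fin 4)), 2 * g ≤ Module.finrank ℂ (TΨ.eigenspace (cs k)) :=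
      fun k _ => hlow (cs k) (hcs4 k)
    have hs : ∑ _k : Fin 4, 2 * g = ∑ k, Module.finrank ℂ (TΨ.eigenspace (cs k)) := by
      rw [hsum, Finset.sum_const, Finset.card_univ, Fintype.card_fin, smul_eq_mul]
    intro k
    exact ((Finset.sum_eq_sum_iff_of_le hle).mp hs k (Finset.mem_univ k)).symm
  refine ⟨hss, ?_, fun hρ => ?_⟩
  · by_cases hμ : TΨ.eigenspace ρ = ⊥
    · rw [hμ, finrank_bot]; exact Nat.zero_le _
    · obtain ⟨k, rfl⟩ := hroot ρ (heig ρ hμ)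
      exact (heq k).le
  · by_cases hμ : TΨ.eigenspace ρ = ⊥
    · rw [hμ, finrank_bot]; omega
    · exact absurd (heig ρ hμ) hρ

/-! ### Conclusion: every `ℚ(ζ₈)`-Weil class on `A₀ ⊗ ℚ(ζ₈)` is algebraic -/

/-- **Each `ℚ(ζ₈)`-Weil line is algebraic.** For every `ρ`, the joint eigenspace
`pullbackEigenclasses A Ψ (2g) ((x + yρ)^{2g})` is contained in the algebraic classes: it is at most a
line (`finrank_pullbackEigenclasses_pow_le_one` with the multiplicities of
`isSemisimple_and_finrank_eigenspace_zetaEight_le`) containing the non-zero algebraic class `P_ρ` of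
`cupPowOne_zetaEight_mem_algebraicClasses_ne_zero` when `ρ⁴ = -1`, and `0` otherwise.
[cite: Deligne1982HodgeCycles, §4 Lemma 4.5, Remark 4.10] -/
theorem pullbackEigenclasses_zetaEight_le_algebraicClasses (hg : 0 < g) (hT : T.dim = g) (ρ : ℂ) :
    let T₂ := T.prod T
    let Φ₁ : T₂ ⟶ T₂ := AbelianVariety.prodLift (AbelianVariety.snd T T ≫ (-(𝟙 T))) (AbelianVariety.fst T T)
    let Ψ : T₂.prod T₂ ⟶ T₂.prod T₂ :=
      AbelianVariety.prodLift (AbelianVariety.snd T₂ T₂ ≫ Φ₁) (AbelianVariety.fst T₂ T₂)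
    let A := T₂.prod T₂
    pullbackEigenclasses A Ψ (2 * g) (fun x y => ((x : ℂ) + (y : ℂ) * ρ) ^ (2 * g)) ≤
      algebraicClasses A.X g := by
  intro T₂ Φ₁ Ψ A
  classical
  haveI := finite_complexBetti_abelianVariety A (2 * g)
  haveI := finite_complexBetti_abelianVariety T 1
  obtain ⟨hss, hmult, hlt⟩ := isSemisimple_and_finrank_eigenspace_zetaEight_le hg hT ρ
  obtain ⟨hle1, hbot⟩ := finrank_pullbackEigenclasses_pow_le_one (N := 2 * g) hss ρ hmult
  by_cases hρ : ρ ^ 4 = -1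
  · have hb₁T : Module.finrank ℂ (complexBetti T.X 1) = 2 * g := by
      rw [AbelianVariety.finrank_complexBetti_one, hT]
    obtain ⟨hPeig, hPalg, hP0⟩ := cupPowOne_zetaEight_mem_algebraicClasses_ne_zero hg hT hρ
      (Module.finBasisOfFinrankEq ℂ _ hb₁T)
    exact le_of_finrank_le_one_of_mem hle1 hPeig hP0 hPalg
  · rw [hbot (hlt hρ)]
    exact bot_le

/-- **R3 on Deligne's `A₀ ⊗ ℚ(ζ₈)`, fact-free: all Weil classes of `F = ℚ(Ψ)` are algebraic.** For
every complex abelian variety `T` of dimension `g ≥ 1` and every `P ∈ ℤ[X]`,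
`weilClassesField A Ψ P (2g) ⊆ algebraicClasses A.X g` on `A = (T × T) × (T × T)` — in particular for
`P = X⁴ + 1` (the minimal polynomial of `Ψ`, `F = ℚ(ζ₈)` a CM field of degree `4 > 2`,
`4 · 2g = 2 dim A`): the body of the Weil-type ladder's rung R3 (`WeilTypeLadder.WeilClassesCMField`) AT
the `g(g+1)/2`-dimensional locus `{T ⊗ ℚ(ζ₈)}`, with no rationality / Hodge-type hypothesis needed.
[cite: Deligne1982HodgeCycles, §4 Lemma 4.5, Remark 4.10] [cite: MoonenZarhin1998WeilClasses, §1] -/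
theorem weilClassesField_zetaEight_le_algebraicClasses (hg : 0 < g) (hT : T.dim = g)
    (P : Polynomial ℤ) :
    let T₂ := T.prod T
    let Φ₁ : T₂ ⟶ T₂ := AbelianVariety.prodLift (AbelianVariety.snd T T ≫ (-(𝟙 T))) (AbelianVariety.fst T T)
    let Ψ : T₂.prod T₂ ⟶ T₂.prod T₂ :=
      AbelianVariety.prodLift (AbelianVariety.snd T₂ T₂ ≫ Φ₁) (AbelianVariety.fst T₂ T₂)
    let A := T₂.prod T₂
    weilClassesField A Ψ P (2 * g) ≤ algebraicClasses A.X g := by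
  intro T₂ Φ₁ Ψ A
  change (⨆ ρ ∈ {ρ : ℂ | Polynomial.eval₂ (Int.castRingHom ℂ) ρ P = 0},
    pullbackEigenclasses A Ψ (2 * g) (fun x y => ((x : ℂ) + (y : ℂ) * ρ) ^ (2 * g))) ≤ _
  exact iSup₂_le fun ρ _ => pullbackEigenclasses_zetaEight_le_algebraicClasses hg hT ρ

/-- Element form of `weilClassesField_zetaEight_le_algebraicClasses`. [cite: Deligne1982HodgeCycles, §4] -/
theorem mem_algebraicClasses_of_mem_weilClassesField_zetaEight (hg : 0 < g) (hT : T.dim = g)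
    (P : Polynomial ℤ) :
    let T₂ := T.prod T
    let Φ₁ : T₂ ⟶ T₂ := AbelianVariety.prodLift (AbelianVariety.snd T T ≫ (-(𝟙 T))) (AbelianVariety.fst T T)
    let Ψ : T₂.prod T₂ ⟶ T₂.prod T₂ :=
      AbelianVariety.prodLift (AbelianVariety.snd T₂ T₂ ≫ Φ₁) (AbelianVariety.fst T₂ T₂)
    let A := T₂.prod T₂
    ∀ c ∈ weilClassesField A Ψ P (2 * g), c ∈ algebraicClasses A.X g :=
  fun _ hc => weilClassesField_zetaEight_le_algebraicClasses hg hT P hc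

end HodgeTheory

end Literature.AlgebraicGeometry.HodgeTheory

end
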